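import Summits.HodgeConjecture.CorCM.Census.NondegenerateReduction
import Summits.HodgeConjecture.CorCM.Census.TwoAdicSplitting
import Summits.HodgeConjecture.CorCM.Census.BaseBlockCovering

/-!
# Nondegenerate splitting: `μ(G,c) = φ₂(G,c)` for a `2`-group from a complete reduction onto a nondegenerate base type

COR-CM (cell `pub-hodgecm2`), count-neutral kernel combinatorics by the binder seat b09 (gen 38; lane TWO-ADIC SPLITTING +
NONDEGENERATE REDUCTION, part D = the assembly of parts A `Census/NondegenerateReduction.lean`, B `Census/TwoAdicSplitting.lean`,
C `Census/BaseBlockCovering.lean`), theorems only: no definition, no `decide`, no certificate, no named fact, no `sorry`.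
HONEST FRAMING: `HC_CM` is NOT proved, here or anywhere in the tree; nothing here is a period or a headline.

**THE META-THEOREM (`isLeast_card_gfaces_generate_of_reduction`).**  Let `G` be a finite `2`-group, `c` a central involution `≠ 1`, `T₀` a CM
type which is NONDEGENERATE (the antisymmetric convolution with `1_{T₀}` is injective — Kubota; certificate form
`Nondegenerate.nondegenerate_of_cert`), and `S ⊆ gfaceSet` a finite FIBRE-INDEPENDENT family of faces (e.g. parity-independent,
`Splitting.fibreIndep_of_parityIndep`; covering families are, `BaseBlock.exists_cover`) such that EVERY CM type reduces modulo
`ℤ⟨pairs⟩ + ℤ⟨base changes of S⟩` to an integer combination of the base changes of `T₀`, up to a power `2^k`.  Then the least number of face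
relations whose base changes generate the Hodge lattice modulo pairs is EXACTLY `φ₂(G,c)`, attained by a family containing `S`:
**`μ(G,c) = φ₂(G,c)`**.  Proof: part A turns the reduction into `2^k · hodgeSpan ⊆ ℤ⟨pairs⟩ + ℤ[G]·S`; part B completes `S` by free
fibre-completing faces and kills the odd index.  With part C the reduction hypothesis is only about the RESIDUAL types of `T₀`
(`isLeast_card_gfaces_generate_of_residual_reduction`): the types at Hamming distance `≤ 1` from a base change of `T₀`.

NECESSARY SHAPE OF `T₀` (numerics of this seat, `HOME/pub-hodgecm2-b09/lean-g38/py/meta.py`): the reduction hypothesis can only hold when the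
translates of `1_{T₀}` span the antisymmetric functions up to a `2`-POWER index (`2`-adic nondegeneracy: e.g. every type of `Q₈`, `Q₁₆`; the
types of Kubota index `4096` of `Q₈ × ℤ/2`, but not those of index `2304 = 2^8·9`); for `D₄` (`c = r²`) every type is degenerate and the
meta-theorem is void there (the row `μ(D₄) = 2` is seat b30ʼs certificate).  For the order-16 groups `C₄∘D₄`, `M₁₆`, `SD₁₆`, `Q₁₆`, `Q₈ × ℤ/2`
(`c = (−1,0)`), `D₁₆` (`c = r⁴`), `ℤ/4 × ℤ/4` a `2`-adically nondegenerate base type with a fibre-independent covering-plus-closing family of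
`≤ φ₂` faces achieving the `2`-power reduction EXISTS (same numerics) — the kernel rows are the successorʼs.

## References
* [Pohlmann1968] H. Pohlmann, Algebraic cycles on abelian varieties of complex multiplication type, Ann. of Math. 88 (1968), Thm 1.
* [Milne1999] J. S. Milne, Lefschetz motives and the Tate conjecture, Compositio Math. 117 (1999), Prop. 2.1, p. 54.
-/

namespace Summit.HodgeConjecture.CorCM.Census.Splitting

open Finset
open Summit.HodgeConjecture.CorCM.Prior.AllgGroup.RfwfAllgGroup
open Summit.HodgeConjecture.CorCM.Census.BlockParity
open Summit.HodgeConjecture.CorCM.Census.Coinvariant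
open Summit.HodgeConjecture.CorCM.Census.Nondegenerate
open Summit.HodgeConjecture.CorCM.Census.BaseBlock

noncomputable section

variable {G : Type*} [Group G] [Fintype G] [DecidableEq G] (c : G)

/-- **META-THEOREM, existence form.**  `2`-group, nondegenerate base type `T₀`, fibre-independent faces `S` reducing every type onto the base
changes of `T₀` up to `2^k` modulo `ℤ⟨pairs⟩ + ℤ⟨base changes of S⟩` `⟹` `S` extends to EXACTLY `φ₂(G,c)` faces generating the Hodge lattice
modulo pairs. [folklore] -/
theorem exists_generate_of_reduction (hG : IsPGroup 2 G) (hc2 : c * c = 1) (hc1 : c ≠ 1) (hcen : ∀ x : G, x * c = c * x)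
    (T₀ : CMF G c)
    (hT₀ : ∀ f : G → ℤ, (∀ Q, f (c * Q) = -f Q) → (∀ x, ∑ Q, f Q * indG T₀.1 (x * Q) = 0) → ∀ Q, f Q = 0)
    (S : Finset (CMF G c →₀ ℤ)) (hS : (↑S : Set (CMF G c →₀ ℤ)) ⊆ gfaceSet G c hc2)
    (hli : LinearIndepOn (ZMod 2) (fun f : CMF G c →₀ ℤ => (rad2 c hc2).mkQ (red c f)) ↑S) (k : ℕ)
    (hred : ∀ Φ : CMF G c, ((2 : ℤ) ^ k) • Finsupp.single Φ (1 : ℤ) ∈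
      (Submodule.span ℤ (pairSet c) ⊔ Submodule.span ℤ (translates c S)) ⊔
        Submodule.span ℤ (Set.range fun Q : G => Finsupp.single (rt c Q T₀) (1 : ℤ))) :
    ∃ S' : Finset (CMF G c →₀ ℤ), S ⊆ S' ∧ (↑S' : Set (CMF G c →₀ ℤ)) ⊆ gfaceSet G c hc2 ∧ S'.card = fibreTwo c hc2 ∧
      hodgeSpan c hc2 ≤ Submodule.span ℤ (pairSet c) ⊔ Submodule.span ℤ (translates c S') :=
  exists_generate_extension_of_isPGroup c hG hc2 hc1 hcen S hS hli k
    (two_pow_smul_mem_psp_of_reduction c hc2 hcen T₀ hT₀ S (hS.trans (gfaceSet_subset_hodgeSpan c hc2)) k hred)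

/-- **META-THEOREM: `μ(G,c) = φ₂(G,c)`** for a `2`-group, from a fibre-independent complete reduction onto a nondegenerate base type. [folklore] -/
theorem isLeast_card_gfaces_generate_of_reduction (hG : IsPGroup 2 G) (hc2 : c * c = 1) (hc1 : c ≠ 1)
    (hcen : ∀ x : G, x * c = c * x) (T₀ : CMF G c)
    (hT₀ : ∀ f : G → ℤ, (∀ Q, f (c * Q) = -f Q) → (∀ x, ∑ Q, f Q * indG T₀.1 (x * Q) = 0) → ∀ Q, f Q = 0)
    (S : Finset (CMF G c →₀ ℤ)) (hS : (↑S : Set (CMF G c →₀ ℤ)) ⊆ gfaceSet G c hc2)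
    (hli : LinearIndepOn (ZMod 2) (fun f : CMF G c →₀ ℤ => (rad2 c hc2).mkQ (red c f)) ↑S) (k : ℕ)
    (hred : ∀ Φ : CMF G c, ((2 : ℤ) ^ k) • Finsupp.single Φ (1 : ℤ) ∈
      (Submodule.span ℤ (pairSet c) ⊔ Submodule.span ℤ (translates c S)) ⊔
        Submodule.span ℤ (Set.range fun Q : G => Finsupp.single (rt c Q T₀) (1 : ℤ))) :
    IsLeast {n : ℕ | ∃ S' : Finset (CMF G c →₀ ℤ), (↑S' ⊆ gfaceSet G c hc2) ∧ S'.card = n ∧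
      hodgeSpan c hc2 ≤ Submodule.span ℤ (pairSet c) ⊔ Submodule.span ℤ (translates c S')} (fibreTwo c hc2) :=
  isLeast_card_gfaces_generate_of_isPGroup c hG hc2 hc1 hcen S hS hli k
    (two_pow_smul_mem_psp_of_reduction c hc2 hcen T₀ hT₀ S (hS.trans (gfaceSet_subset_hodgeSpan c hc2)) k hred)

/-- **Parity form**: the same with block-parity independence of `S` (a sufficient criterion for fibre independence). [folklore] -/
theorem isLeast_card_gfaces_generate_of_reduction_par (hG : IsPGroup 2 G) (hc2 : c * c = 1) (hc1 : c ≠ 1)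
    (hcen : ∀ x : G, x * c = c * x) (T₀ : CMF G c)
    (hT₀ : ∀ f : G → ℤ, (∀ Q, f (c * Q) = -f Q) → (∀ x, ∑ Q, f Q * indG T₀.1 (x * Q) = 0) → ∀ Q, f Q = 0)
    (S : Finset (CMF G c →₀ ℤ)) (hS : (↑S : Set (CMF G c →₀ ℤ)) ⊆ gfaceSet G c hc2)
    (hpar : LinearIndepOn (ZMod 2) (fun f : CMF G c →₀ ℤ => par c f) ↑S) (k : ℕ)
    (hred : ∀ Φ : CMF G c, ((2 : ℤ) ^ k) • Finsupp.single Φ (1 : ℤ) ∈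
      (Submodule.span ℤ (pairSet c) ⊔ Submodule.span ℤ (translates c S)) ⊔
        Submodule.span ℤ (Set.range fun Q : G => Finsupp.single (rt c Q T₀) (1 : ℤ))) :
    IsLeast {n : ℕ | ∃ S' : Finset (CMF G c →₀ ℤ), (↑S' ⊆ gfaceSet G c hc2) ∧ S'.card = n ∧
      hodgeSpan c hc2 ≤ Submodule.span ℤ (pairSet c) ⊔ Submodule.span ℤ (translates c S')} (fibreTwo c hc2) :=
  isLeast_card_gfaces_generate_of_reduction c hG hc2 hc1 hcen T₀ hT₀ S hS (fibreIndep_of_parityIndep c hc2 _ hpar) k hred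

/-- **RESIDUAL FORM** (with the covering of part C).  `2`-group, nondegenerate `T₀`; a family `S ⊆ gfaceSet` which CONTAINS a covering family of
`T₀` (i.e. modulo `ℤ⟨base changes of S⟩` every type is a combination of RESIDUAL types, `bpot T₀ ≤ 1`), is fibre-independent, and reduces every
RESIDUAL type onto the base changes of `T₀` up to `2^k` `⟹ μ(G,c) = φ₂(G,c)`. [folklore] -/
theorem isLeast_card_gfaces_generate_of_residual_reduction (hG : IsPGroup 2 G) (hc2 : c * c = 1) (hc1 : c ≠ 1)
    (hcen : ∀ x : G, x * c = c * x) (T₀ : CMF G c)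
    (hT₀ : ∀ f : G → ℤ, (∀ Q, f (c * Q) = -f Q) → (∀ x, ∑ Q, f Q * indG T₀.1 (x * Q) = 0) → ∀ Q, f Q = 0)
    (S : Finset (CMF G c →₀ ℤ)) (hS : (↑S : Set (CMF G c →₀ ℤ)) ⊆ gfaceSet G c hc2)
    (hli : LinearIndepOn (ZMod 2) (fun f : CMF G c →₀ ℤ => (rad2 c hc2).mkQ (red c f)) ↑S)
    (hcov : ∀ Φ : CMF G c, Finsupp.single Φ (1 : ℤ) ∈
      (Submodule.span ℤ (pairSet c) ⊔ Submodule.span ℤ (translates c S)) ⊔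
        Submodule.span ℤ ((fun Ψ => Finsupp.single Ψ (1 : ℤ)) '' {Ψ : CMF G c | bpot c T₀ Ψ ≤ 1})) (k : ℕ)
    (hres : ∀ Ψ : CMF G c, bpot c T₀ Ψ ≤ 1 → ((2 : ℤ) ^ k) • Finsupp.single Ψ (1 : ℤ) ∈
      (Submodule.span ℤ (pairSet c) ⊔ Submodule.span ℤ (translates c S)) ⊔
        Submodule.span ℤ (Set.range fun Q : G => Finsupp.single (rt c Q T₀) (1 : ℤ))) :
    IsLeast {n : ℕ | ∃ S' : Finset (CMF G c →₀ ℤ), (↑S' ⊆ gfaceSet G c hc2) ∧ S'.card = n ∧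
      hodgeSpan c hc2 ≤ Submodule.span ℤ (pairSet c) ⊔ Submodule.span ℤ (translates c S')} (fibreTwo c hc2) :=
  isLeast_card_gfaces_generate_of_reduction c hG hc2 hc1 hcen T₀ hT₀ S hS hli k
    (reduction_of_residual c T₀ _ {Ψ : CMF G c | bpot c T₀ Ψ ≤ 1} k hcov (fun Ψ hΨ => hres Ψ hΨ))

/-- **The covering makes the first residual hypothesis automatic**: for every base type `T₀` there is a parity-independent covering family `S₀`
(EXACTLY one face per block of potential `≥ 2`) such that every family `S ⊇ S₀` reduces all types to the residual ones. [folklore] -/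
theorem exists_cover_sub (hc2 : c * c = 1) (T₀ : CMF G c) :
    ∃ S₀ : Finset (CMF G c →₀ ℤ), (↑S₀ ⊆ gfaceSet G c hc2) ∧
      S₀.card = (univ.filter fun Bk : Block c => 2 ≤ bpot c T₀ Bk.out).card ∧
      LinearIndepOn (ZMod 2) (fun f : CMF G c →₀ ℤ => par c f) ↑S₀ ∧
      (∀ f ∈ S₀, ∃ Ψ : CMF G c, 2 ≤ bpot c T₀ Ψ ∧ par c f (blk c Ψ) = 1 ∧
        ∀ B : Block c, B ≠ blk c Ψ → bpot c T₀ Ψ ≤ bpot c T₀ B.out → par c f B = 0) ∧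
      ∀ S : Finset (CMF G c →₀ ℤ), S₀ ⊆ S → ∀ Φ : CMF G c, Finsupp.single Φ (1 : ℤ) ∈
        (Submodule.span ℤ (pairSet c) ⊔ Submodule.span ℤ (translates c S)) ⊔
          Submodule.span ℤ ((fun Ψ => Finsupp.single Ψ (1 : ℤ)) '' {Ψ : CMF G c | bpot c T₀ Ψ ≤ 1}) := by
  obtain ⟨S₀, hS₀, hcard, hli, hprof, hres⟩ := exists_cover_residual c T₀ hc2
  refine ⟨S₀, hS₀, hcard, hli, hprof, fun S hS₀S Φ => hres _ ?_ Φ⟩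
  have hsub : translates c S₀ ⊆ translates c S := by
    rintro _ ⟨Q, s, hs, rfl⟩
    exact ⟨Q, s, hS₀S hs, rfl⟩
  exact (Submodule.span_mono hsub).trans le_sup_right

end

end Summit.HodgeConjecture.CorCM.Census.Splitting
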